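import Summits.QuantumFields.BalabanUV.T4Continuum.Support.ActivityTermModel

/-!
# NE5 ∕ U3, route P2 — `ReadLip` (how the operator slot of a (2.14)-term is NORMED) holds BY CONSTRUCTION for read-outs that
# are bounded-linear in the operator datum (skeleton `t4/skeletons/NE5-t4-ne5-p2.md` §6 row A4; leaf L05, operator half)

Cell `pub-balaban`, unit `b2b-balaban-t4-ne5-p2-g17` (T⁴ fan-out NE5 ∕ node U3, PROVER seat P2 «polymer-activity Lipschitz route»).
Summits-side new work under the LEAN PLACEMENT RULE (cell modelling + bookkeeping; NOT a Literature module).  HONEST FRAMING: rung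
(B)+1 of the FINITE-VOLUME T⁴ continuum programme — NOT infinite volume, NOT a mass gap, NOT the Clay problem, NOT a proof of NE5
(NOT PRINTED in [Balaban1987RG1]–[Balaban1989LargeFieldII]; they print ε-UNIFORM bounds, never η-RATES).  HONEST DEPENDENCY (cell
line, verbatim): continuum YM on T⁴ ⇐ BetaPertH ∧ nine spine estimates (0/9 proved); BetaPertH ⇐ (D1) ∧ (D4) ∧ CAP+tail; G-an2-4
gates asym, D1 and NE2/3/4.

WHAT THIS FILE DOES.  The term model (`Support/ActivityTermDatum` ∕ `…Slot` ∕ `…Model`, p195577∕p195644∕p195718) proves the activity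
route's located wall `ActivityLipschitz₂` from per-term data; one of these data is the hypothesis shape
`TermDatum.ReadLip 𝔱 𝔠 ϱOp ϱHist` — HOW THE TWO-SPECIES INPUT IS NORMED: the kernel read-outs `kL ∕ kA ∕ kP` (Gaussian data of
[Balaban1988RG2Cluster] (2.14)–(2.17) p. 15–16) and the potential read-outs `kQ ∕ kR` ((1.42)∕(2.19)) move by at most `κ•·(‖o − o′‖∕ϱOp)`
times their one-run entry-weight formats, and the history read-out is additive with the unit bound (`read_of_clm`, part 3).  The row
owner's O1 design (`t4/b2b-balaban-t4-ne5-p1/B13StepDesign.md` v0.1, RULE R2) types the operator datum `Op` as the finite family of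
unit-lattice kernel species the step reads; if the term model READS that datum through BOUNDED ℂ-LINEAR maps (coordinate projections
in particular), `ReadLip`'s five operator clauses hold BY CONSTRUCTION with moduli `κ• = ϱOp·λ•`, `λ•` the operator norms of the
read-outs in the entry-weight formats — no estimate, a NORMALISATION.  We prove exactly that:
* `LinearReadouts` (DATA): the read-out functionals `LL a′ i`, `LA i j`, `LP a′ a″ : Op →L[ℂ] ℂ`, `LQ x Y b b′`, `LR x Y : Op →L[ℂ] ℂ`;
  `Reads` (the term's `kL kA kP kQ kR` ARE these functionals); `Calibrated λL λA λP λQ λR` (their operator norms in the formats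
  `e^{−2δd}`, `e^{−2δd}`, `e^{−δd}`, `w(Y)k(b,b′)∕‖τ Y‖`-type, `v(Y)`-type — one-run KIND, the (2.16)∕(1.43) entry formats);
* `readLip_of_linear`: `Reads ∧ Calibrated ∧ (ϱOp·λ• ≤ 𝔠.κ•) ∧ ReadAdditive ∧ ReadUnitBound ⟹ 𝔱.ReadLip 𝔠 ϱOp ϱHist`;
* `readLip_of_linear_clm`: the same with the history clauses ALSO by construction from a bounded-linear history read-out
  (`ActivityTermModel.read_of_clm`).
So for linearly-read operator data leaf L05's `ReadLip` reduces to the reading + the calibration of the norm on `Op`; nothing of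
the manuscripts under audit is asserted (cited for KIND∕locus only).  0 sorry; no new axioms.
-/

open scoped BigOperators

namespace Summit.QuantumFields.BalabanUV.T4Continuum.ActivityTermReadouts

open Literature.MathematicalPhysics.QuantumFieldTheory.Balaban1983to89.T4ActivityTiltHistory (ReadAdditive ReadUnitBound)
open Summit.QuantumFields.BalabanUV.T4Continuum.ActivityTermModel (TermDatum TermConsts read_of_clm)

variable {Op Hist ι κ S Ω Ω₀ 𝒴 𝒞 : Type*} [Fintype ι] [Fintype κ] [MeasurableSpace Ω] [MeasurableSpace Ω₀]
  [NormedAddCommGroup Op] [NormedSpace ℂ Op] [NormedAddCommGroup Hist] [NormedSpace ℂ Hist]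

/-- [folklore] The one generic inequality: a bounded linear functional with operator norm `≤ lam·wt` moves by at most
`(ϱ·lam)·(‖o − o′‖∕ϱ)·wt` between two data (`ϱ > 0`). -/
theorem norm_clm_sub_le (ℓ : Op →L[ℂ] ℂ) {lam wt ϱ : ℝ} (hϱ : 0 < ϱ) (hℓ : ‖ℓ‖ ≤ lam * wt) (o o' : Op) :
    ‖ℓ o - ℓ o'‖ ≤ ϱ * lam * (‖o - o'‖ / ϱ) * wt := by
  rw [← map_sub]
  calc ‖ℓ (o - o')‖ ≤ ‖ℓ‖ * ‖o - o'‖ := ℓ.le_opNorm _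
    _ ≤ lam * wt * ‖o - o'‖ := mul_le_mul_of_nonneg_right hℓ (norm_nonneg _)
    _ = ϱ * lam * (‖o - o'‖ / ϱ) * wt := by field_simp
 
/-- [folklore] The same with a scalar weight `τ` in front (the potential formats carry `τ(Y)`). -/
theorem norm_mul_clm_sub_le (ℓ : Op →L[ℂ] ℂ) (τ : ℂ) {lam wt ϱ : ℝ} (hϱ : 0 < ϱ) (hℓ : ‖τ‖ * ‖ℓ‖ ≤ lam * wt)
    (o o' : Op) : ‖τ * (ℓ o - ℓ o')‖ ≤ ϱ * lam * (‖o - o'‖ / ϱ) * wt := by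
  rw [← map_sub, norm_mul]
  calc ‖τ‖ * ‖ℓ (o - o')‖ ≤ ‖τ‖ * (‖ℓ‖ * ‖o - o'‖) := mul_le_mul_of_nonneg_left (ℓ.le_opNorm _) (norm_nonneg _)
    _ = ‖τ‖ * ‖ℓ‖ * ‖o - o'‖ := by ring
    _ ≤ lam * wt * ‖o - o'‖ := mul_le_mul_of_nonneg_right hℓ (norm_nonneg _)
    _ = ϱ * lam * (‖o - o'‖ / ϱ) * wt := by field_simp

/-- [folklore] DATA: the operator read-outs of a term as bounded ℂ-linear functionals of the operator datum (coordinate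
projections of the O1 design's `OpDatum` in particular). -/
structure LinearReadouts (Op : Type*) [NormedAddCommGroup Op] [NormedSpace ℂ Op] (ι κ Ω 𝒴 : Type*) where
  LL : κ → ι → (Op →L[ℂ] ℂ)
  LA : ι → ι → (Op →L[ℂ] ℂ)
  LP : κ → κ → (Op →L[ℂ] ℂ)
  LQ : Ω → 𝒴 → κ → κ → (Op →L[ℂ] ℂ)
  LR : Ω → 𝒴 → (Op →L[ℂ] ℂ)

namespace LinearReadouts

variable (ℒ : LinearReadouts Op ι κ Ω 𝒴) (𝔱 : TermDatum Op Hist ι κ S Ω Ω₀ 𝒴 𝒞) (𝔠 : TermConsts)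

/-- [folklore] HYPOTHESIS SHAPE (reading): the term's five operator read-outs ARE the linear functionals. -/
structure Reads : Prop where
  hL : ∀ o a' i, 𝔱.kL o a' i = ℒ.LL a' i o
  hA : ∀ o i j, 𝔱.kA o i j = ℒ.LA i j o
  hP : ∀ o a' a'', 𝔱.kP o a' a'' = ℒ.LP a' a'' o
  hQ : ∀ o x Y b b', 𝔱.kQ o x Y b b' = ℒ.LQ x Y b b' o
  hR : ∀ o x Y, 𝔱.kR o x Y = ℒ.LR x Y o

/-- [folklore] HYPOTHESIS SHAPE (CALIBRATION of the norm on `Op`, one-run KIND: the read-outs' operator norms in the entry-weight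
formats of [Balaban1988RG2Cluster] (2.16) p. 16 ∕ (1.43) p. 11 — how `‖·‖_Op` dominates the weighted entries). -/
structure Calibrated (lamL lamA lamP lamQ lamR : ℝ) : Prop where
  hL : ∀ a' i, ‖ℒ.LL a' i‖ ≤ lamL * Real.exp (-(2 * 𝔠.δ * 𝔱.d (𝔱.q a') (𝔱.p i)))
  hA : ∀ i j, ‖ℒ.LA i j‖ ≤ lamA * Real.exp (-(2 * 𝔠.δ * 𝔱.d (𝔱.p i) (𝔱.p j)))
  hP : ∀ a' a'', ‖ℒ.LP a' a''‖ ≤ lamP * Real.exp (-(𝔠.δ * 𝔱.d (𝔱.q a') (𝔱.q a'')))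
  hQ : ∀ x, ∀ Y ∈ 𝔱.D, ∀ b ∈ 𝔱.bonds Y, ∀ b' ∈ 𝔱.bonds Y, ‖𝔱.τ Y‖ * ‖ℒ.LQ x Y b b'‖ ≤ lamQ * (𝔱.w Y * 𝔱.kk b b')
  hR : ∀ x, ∀ Y ∈ 𝔱.D, ‖𝔱.τ Y‖ * ‖ℒ.LR x Y‖ ≤ lamR * 𝔱.v Y

variable {ℒ 𝔱 𝔠}

omit [NormedSpace ℂ Hist] in
/-- [folklore] **`ReadLip` BY CONSTRUCTION for linearly-read operator data.**  Reading + calibration + `ϱOp·λ• ≤ κ•` (the term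
constants' moduli dominate the calibrated ones in margin units) + the two history clauses ⟹ `𝔱.ReadLip 𝔠 ϱOp ϱHist`. -/
theorem readLip_of_linear [DecidableEq ι] [DecidableEq κ] [DecidableEq 𝒞] {lamL lamA lamP lamQ lamR ϱOp ϱHist : ℝ}
    (hread : ℒ.Reads 𝔱) (hcal : ℒ.Calibrated 𝔱 𝔠 lamL lamA lamP lamQ lamR) (hgeo : 𝔱.Geometry 𝔠) (hϱ : 0 < ϱOp)
    (hκL : ϱOp * lamL ≤ 𝔠.κL) (hκA : ϱOp * lamA ≤ 𝔠.κA) (hκP : ϱOp * lamP ≤ 𝔠.κP) (hκQ : ϱOp * lamQ ≤ 𝔠.κQ)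
    (hκR : ϱOp * lamR ≤ 𝔠.κR) (hadd : ReadAdditive 𝔱.read) (hunit : ReadUnitBound 𝔱.read 𝔱.D 𝔱.τ 𝔱.v ϱHist) :
    𝔱.ReadLip 𝔠 ϱOp ϱHist where
  hkL o o' a' i := by
    rw [hread.hL o, hread.hL o']
    have hw : 0 ≤ Real.exp (-(2 * 𝔠.δ * 𝔱.d (𝔱.q a') (𝔱.p i))) := (Real.exp_pos _).le
    exact (norm_clm_sub_le _ hϱ (hcal.hL a' i) o o').trans
      (mul_le_mul_of_nonneg_right (mul_le_mul_of_nonneg_right hκL (div_nonneg (norm_nonneg _) hϱ.le)) hw)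
  hkA o o' i j := by
    rw [hread.hA o, hread.hA o']
    have hw : 0 ≤ Real.exp (-(2 * 𝔠.δ * 𝔱.d (𝔱.p i) (𝔱.p j))) := (Real.exp_pos _).le
    exact (norm_clm_sub_le _ hϱ (hcal.hA i j) o o').trans
      (mul_le_mul_of_nonneg_right (mul_le_mul_of_nonneg_right hκA (div_nonneg (norm_nonneg _) hϱ.le)) hw)
  hkP o o' a' a'' := by
    rw [hread.hP o, hread.hP o']
    have hw : 0 ≤ Real.exp (-(𝔠.δ * 𝔱.d (𝔱.q a') (𝔱.q a''))) := (Real.exp_pos _).le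
    exact (norm_clm_sub_le _ hϱ (hcal.hP a' a'') o o').trans
      (mul_le_mul_of_nonneg_right (mul_le_mul_of_nonneg_right hκP (div_nonneg (norm_nonneg _) hϱ.le)) hw)
  hkQ o o' x Y hY b hb b' hb' := by
    rw [hread.hQ o, hread.hQ o']
    have hw : 0 ≤ 𝔱.w Y * 𝔱.kk b b' := mul_nonneg (hgeo.hw Y hY) (hgeo.hk b b')
    exact (norm_mul_clm_sub_le _ _ hϱ (hcal.hQ x Y hY b hb b' hb') o o').trans
      (mul_le_mul_of_nonneg_right (mul_le_mul_of_nonneg_right hκQ (div_nonneg (norm_nonneg _) hϱ.le)) hw)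
  hkR o o' x Y hY := by
    rw [hread.hR o, hread.hR o']
    have hw : 0 ≤ 𝔱.v Y := hgeo.hv Y hY
    exact (norm_mul_clm_sub_le _ _ hϱ (hcal.hR x Y hY) o o').trans
      (mul_le_mul_of_nonneg_right (mul_le_mul_of_nonneg_right hκR (div_nonneg (norm_nonneg _) hϱ.le)) hw)
  hadd := hadd
  hunit := hunit

/-- [folklore] **… with the history clauses also by construction**: if moreover the history read-out is bounded-linear at every
`(Y, x)` with norms in the `v(Y)∕ϱHist` format (`ActivityTermModel.read_of_clm`), ALL seven clauses of `ReadLip` hold. -/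
theorem readLip_of_linear_clm [DecidableEq ι] [DecidableEq κ] [DecidableEq 𝒞] {lamL lamA lamP lamQ lamR ϱOp ϱHist : ℝ}
    (hread : ℒ.Reads 𝔱) (hcal : ℒ.Calibrated 𝔱 𝔠 lamL lamA lamP lamQ lamR) (hgeo : 𝔱.Geometry 𝔠) (hϱ : 0 < ϱOp)
    (hκL : ϱOp * lamL ≤ 𝔠.κL) (hκA : ϱOp * lamA ≤ 𝔠.κA) (hκP : ϱOp * lamP ≤ 𝔠.κP) (hκQ : ϱOp * lamQ ≤ 𝔠.κQ)
    (hκR : ϱOp * lamR ≤ 𝔠.κR) (LH : 𝒴 → Ω → (Hist →L[ℂ] ℂ)) (hH : ∀ h Y x, 𝔱.read h Y x = LH Y x h)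
    (hϱH : 0 < ϱHist) (hLH : ∀ Y ∈ 𝔱.D, ∀ x, ‖𝔱.τ Y‖ * ‖LH Y x‖ ≤ 𝔱.v Y / ϱHist) : 𝔱.ReadLip 𝔠 ϱOp ϱHist := by
  have hread_eq : 𝔱.read = fun h Y x => LH Y x h := funext fun h => funext fun Y => funext fun x => hH h Y x
  obtain ⟨hadd, hunit⟩ := read_of_clm LH 𝔱.D 𝔱.τ 𝔱.v hϱH hLH
  rw [← hread_eq] at hadd hunit
  exact readLip_of_linear hread hcal hgeo hϱ hκL hκA hκP hκQ hκR hadd hunit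

end LinearReadouts

end Summit.QuantumFields.BalabanUV.T4Continuum.ActivityTermReadouts
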